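import Literature.MathematicalPhysics.QuantumFieldTheory.Balaban1983to89.B8Prop5JoinSectELocalRD
import HarnessLib

/-!
# `UnitScaleTiltHalvingP1FlatCoreTopStep` — line H (`BirthV10.stub_halvingStep`, stmt-QuantumFields-19200), T2♭-PLAN v1.1 #46 §3 **J4c**:
# PROPOSITION 5's k-LEVEL STEP WITH A GENERIC TOP RESTRICTION — the repaired JOIN-B of record
# (`B8Prop5JoinSectELocalRD.hFP_kLevel_of179_local_RD`) and the step wrapper (`B8Prop5KLevelLetters.hP5_step_of_HFP`) RE-RUN with the
# printed axial restriction (1.29)∕(1.79) REPLACED by an arbitrary restriction predicate `P` transferred from the linear constraint `Q′λ = 0`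
# — so that the LAST step of [B8] Thm 2∕4's level induction can carry the H-line's top normalisation (o) (`DP1Clause`) instead of (1.29)_k

WHY (cell `ym3-torus`, route `UnitScaleTilt`, crux `MinimiserStabilityRegPr` = stmt-QuantumFields-19200, line H; LEAD-H ★w5-19200 g4's T2♭-PLAN v1.1 addendum
#46 §3 J4 «N05's induction is modular per level; levels `m < k` keep print's `Restr129_m`; the LAST step must produce `Lan k W ∧ (o)` instead of `Lan k W ∧
Restr129_k`»; ★★OWNER ACK 45 (b); this seat's LOCATE `ym-ust-19936-w3/J4C-LOCATE-w3g6.md` = 19200 evidence #51).  LOCATED: in both N05 theorems the restriction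
functional is a PASS-THROUGH — `hFP_kLevel_of179_local_RD` uses its whole «tower-local regime» block and the Sect. E transfer `h179E` ONLY in the final bullet
(`restr129_mul_gaugeExp_local … (h179E s hs hq)`), and `hP5_step_of_HFP` hands `Restr129 … (u₁ * gaugeExp lam)` through verbatim; the contraction (JOIN-A
`gaugeParam_kLevel`), the projection laws (`q (lamOf s) = 0` by `q_g_proj325_range`, `Δλ_s = R(−Z)` pointwise on `Ω₀`), (1.108), reality, support and the
multiplier form of the Landau equation (`multiplier_iff_of_whyZ`) read NOTHING of the restriction and take Sect. E's correction `H_c` as a FREE LETTER with eight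
displayed binders.  THIS FILE therefore proves, by the SAME proofs:
* §1 ★★ `hFP_kLevel_ofConstraint_RD` — JOIN-B (RD letters of [4]: `g_rightΩ` pointwise on `Ω₀`, `c_range`) for ANY correction `H_c` (eight binders) and ANY
  restriction predicate `P : (Site d → 𝔸) → Prop` with the displayed transfer `hP : ‖s‖ ≤ ¼α₄ → Q′λ_s = 0 → P (λ_s + H_cλ_s)`: ∃ `λ′` Hermitian, `= 0` off
  `Ω₀`, (1.108) on the bonds `Eb j`, the multiplier form `Δ↾Ω₀[D*A + Δλ′ + 𝔑(λ′)] = Q′ᵀμ` on `Ω₀`, and `P λ′`;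
* §1 (this file) ★★ `hFP_kLevel_agnostic_RD` (raw form: the fixed point `s`, `Q′λ_s = 0`, `λ′ = λ_s + H_cλ_s` exposed) and ★★ `hFP_kLevel_ofConstraint_RD` (the
  `P`-form); the sibling `…TopStepSocket` carries §2 ★★ `p5Step_ofConstraint_of_HFP` (the step wrapper `hP5_step_of_HFP` with `Restr129 ↦ P`: `v := e^{iλ}` unitary,
  `= 1` off `Ω₀`, (1.108), `U₁^{v⁻¹}` satisfies `IsLandau138W L (m+1)`, `P λ`) and §3 ★ the sanity corollary (the tree's JOIN-B = §1 at `P := Restr129 … (u₁·e^{iλ})`,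
  transfer by `restr129_mul_gaugeExp_local`).
The (o)-instance (`P := (o)` of the composite gauge, transfer = J4b's (1.114) for the MIXED functional `(Q′_j)_{j<k} ⊕ (o)_k`, ★w8-19936 s2) and the extraction to
`core′` (J5, ★w7-19936 g4) plug into §1∕§2 by `exact`; LEAD-H words the (o) letters.
HONEST FRAMING.  By-name re-assembly of landed `pub-ymgap`∕`lit-balaban` theorems ([B8] Sect. D–E); nothing of [4] ((1.91)–(1.101)), of [3] Prop. 10 or of Sect. E's estimates
is proved here — they stay DISPLAYED exactly as in the N05 files; no restriction-specific content at all.  Count-neutral helper (`--supports stmt-QuantumFields-19200 --as helper`,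
★★OWNER-worded tag, ACK 45); registry∕binders∕skeleton text untouched (J r4).  YM₃ on T³ is rung R3 of the programme, NOT the Clay problem; nothing here is about d = 4,
the continuum, or a mass gap; `core`, the stub and the crux are NOT proved by this file.

References: T. Bałaban, Commun. Math. Phys. 99 (1985) 75–102 [Balaban1985RegularSpaces] (Prop. 5 (1.107)–(1.109) p.94, (1.95)–(1.106) pp.92–94, (1.113)–(1.114) p.95,
(1.29) p.81, (1.38) p.82); Commun. Math. Phys. 98 (1985) 17–51 [Balaban1985Averaging] ((213)–(214) p.50).
-/

set_option autoImplicit false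

noncomputable section

open NormedSpace Metric Set
open Complex (I)

namespace Summit.QuantumFields.YangMills.Theorems.HalvingP1FlatCoreTopStep

open Literature.MathematicalPhysics.QuantumFieldTheory.Balaban1983to89
open B7Prop1Explicit (e U1 expUnit val_expUnit)
open B7Prop2Explicit (unitaryUnits mem_unitaryUnits unitaryUnits_le_U1)
open B7Eq78Linearization (conjR)
open B7Eq92Concrete (mgauge mgauge_apply)
open B8Ineq132 (covDerivFwd covDeriv BondTouches)
open B8Eq140Level (SideTouches)
open B8Eq119TwistedAxial (Restr129 InAx)
open B8Eq138LandauZd (covLap covDivB QT IsLandau138W)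
open B8Eq182Proof (gAd)
open B8Eq184Proof (gaugeExp cfgExp)
open B8Eq188Proof (frakF3 gAd_neg)
open B8LambdaSpaceKLevel (wt lamSubK lamOf norm_le_iff)
open B8Prop5ContractionKLevel (Bd2 Zsol Vop Wsrc PsiP5 Mc Kc)
open B8Prop5GaugeParamKLevel (gaugeParam_kLevel gpar_size)
open B8Prop5KLevelLetters (multiplier_iff_of_whyZ isLandau138W_gaugeFixed_of_multiplier)
open B8Eq195Linear (proj325_sub)
open B8Eq195LinearRange (q_g_proj325_range)
open B8Prop5JoinSectELocal (restr129_mul_gaugeExp_local)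
open B8Prop5JoinHFP (covLap_neg')
open B8Eq178Averages (Cond179)
open B7Prop1Local (InBox pdevOn)
open B7Prop3Flat (expCfg c3)
open B7Prop2Explicit (C0 c2')
open B7Prop10General (C6 C4G)
open B7Prop9Flat (C5')
open B8Ineq130 (tlo thi)

-- `Site` alone could resolve to the torus sites of `Setup.lean`; use the `ℤ^d` sites of `B7Prop1Explicit`.
open B7Prop1Explicit (Site)

variable {d : ℕ} {𝔸 : Type*} [CStarAlgebra 𝔸] [Nontrivial 𝔸]

/-! ## §1 JOIN-B (RD letters) with a GENERIC restriction predicate transferred from the linear constraint -/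

section Generic

variable {L k : ℕ} {η : ℝ} {Ω Λs : ℕ → Set (Site d)} {Eb : ℕ → Set (Site d × Fin d)} {U₀ : Site d → Fin d → 𝔸ˣ}
  {A : Site d → Fin d → 𝔸}

/-- ★★ **PROPOSITION 5's FIXED POINT IN THE KNIT'S CURRENCY, RESTRICTION-AGNOSTIC** — `B8Prop5JoinSectELocalRD.hFP_kLevel_of179_local_RD` VERBATIM (letters
`g Δ q qs Aw c` of [4] with `g_rightΩ` pointwise on `Ω₀` and `c_range`; the correction `H_c` a free letter with its eight binders; JOIN-B's windows; (1.101)∕(1.98)R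
with Dirichlet range and reality; the datum `A`; smallness (1.103)∕(1.106)) EXCEPT that the printed restriction (1.29) — which that theorem reads only in its last proof
line — is DROPPED and the raw output of the contraction is EXPOSED instead: the fixed point `s` in the ¼α₄-ball of `lamSubK`, the LINEAR CONSTRAINT `Q′λ_s = 0` it
satisfies (range of `G′R`), and `λ′ = λ_s + H_cλ_s`; then `λ′` Hermitian, `= 0` off `Ω₀`, (1.108) on `Eb j` (`j ≤ k`), and the multiplier form of the Landau equation
on `Ω₀`.  Every restriction functional whose vanishing follows from `Q′λ_s = 0` through Sect. E's (1.114) — print's (1.29) (§3), the H-line's (o) (J4b) — is then a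
corollary (`hFP_kLevel_ofConstraint_RD`). [cite: Balaban1985RegularSpaces, Prop. 5 (1.107)–(1.109) p.94, (1.95)–(1.106) pp.92–94, (1.113)–(1.114) p.95] -/
theorem hFP_kLevel_agnostic_RD (hL : 1 ≤ L) (hη : 0 < η) (hU₀ : ∀ x κ, U₀ x κ ∈ unitaryUnits 𝔸)
    (hEbΩ : ∀ j, j ≤ k → ∀ x ∈ Ω j, ∀ μ : Fin d, (x, μ) ∈ Eb j ∧ (x - e μ, μ) ∈ Eb j)
    -- letters of [4]
    (g Δ : (Site d → 𝔸) →ₗ[ℂ] (Site d → 𝔸)) (q : (Site d → 𝔸) →ₗ[ℂ] (ℕ → Site d → 𝔸)) (qs : (ℕ → Site d → 𝔸) →ₗ[ℂ] (Site d → 𝔸))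
    (Aw c : (ℕ → Site d → 𝔸) →ₗ[ℂ] (ℕ → Site d → 𝔸))
    (g_rightΩ : ∀ x, ∀ y ∈ Ω 0, (Δ (g x) + qs (Aw (q (g x)))) y = x y)
    (c_range : ∀ f, q (g (g (qs (c (q f))))) = q f)
    (hΔ : ∀ (f : Site d → 𝔸), ∀ x ∈ Ω 0, Δ f x = covLap η U₀ ((Ω 0).indicator f) x)
    (hqs : ∀ (μ : ℕ → Site d → 𝔸), ∀ x ∈ Ω 0, qs μ x = QT L k Λs U₀ μ x)
    (Hc : (Site d → 𝔸) → (Site d → 𝔸))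
    -- JOIN-B's windows, letters G′/R, H_c's eight binders, the datum
    {α₄ BG BR h₀ h₁ h₂ l₀ l₁ l₂ cA cDA : ℝ}
    (hα₄ : 0 < α₄) (hBG : 0 ≤ BG) (hBR : 0 ≤ BR) (hh₀ : 0 ≤ h₀) (hh₂ : 0 ≤ h₂) (hl₀ : 0 ≤ l₀) (hl₁ : 0 ≤ l₁)
    (hl₂ : 0 ≤ l₂) (hcA : 0 ≤ cA) (hcA' : cA ≤ 1 / 13) (hcDA : 0 ≤ cDA)
    (ha₁' : α₄ / 4 + h₀ ≤ 1 / 24) (hb₁' : α₄ / 4 + h₁ ≤ 1 / 140) (hb₁ : 0 < α₄ / 4 + h₁) (hθ : 10 * (α₄ / 4 + h₀) * BR ≤ 1 / 2)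
    (hh₀' : h₀ ≤ 3 * α₄ / 4) (hh₁' : h₁ ≤ 3 * α₄ / 4)
    (hG : ∀ (f : Site d → 𝔸) (m : ℝ), 0 ≤ m → Bd2 L η k Ω f m →
      (∀ x, ‖g f x‖ ≤ BG * m) ∧ ∀ j, j ≤ k → ∀ p ∈ Eb j, wt L η j * ‖covDerivFwd η U₀ p.2 (g f) p.1‖ ≤ BG * m)
    (hGsupp : ∀ (f : Site d → 𝔸) (x : Site d), x ∉ Ω 0 → g f x = 0)
    (hGreal : ∀ f : Site d → 𝔸, (∀ j, j ≤ k → ∀ x ∈ Ω j, IsSelfAdjoint (f x)) → ∀ x, IsSelfAdjoint (g f x))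
    (hRbd : ∀ (f : Site d → 𝔸) (m : ℝ), 0 ≤ m → Bd2 L η k Ω f m → Bd2 L η k Ω (f - g (qs (c (q (g f))))) (BR * m))
    (hRreal : ∀ f : Site d → 𝔸, (∀ j, j ≤ k → ∀ x ∈ Ω j, IsSelfAdjoint (f x)) →
      ∀ j, j ≤ k → ∀ x ∈ Ω j, IsSelfAdjoint ((f - g (qs (c (q (g f))))) x))
    (hc0 : ∀ s : lamSubK η U₀ L k Eb, ‖s‖ ≤ α₄ / 4 → ∀ x, ‖Hc (lamOf s) x‖ ≤ h₀)
    (hc1 : ∀ s : lamSubK η U₀ L k Eb, ‖s‖ ≤ α₄ / 4 → ∀ j, j ≤ k → ∀ p ∈ Eb j, wt L η j * ‖covDerivFwd η U₀ p.2 (Hc (lamOf s)) p.1‖ ≤ h₁)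
    (hc2 : ∀ s : lamSubK η U₀ L k Eb, ‖s‖ ≤ α₄ / 4 → Bd2 L η k Ω (covLap η U₀ (Hc (lamOf s))) h₂)
    (hcL0 : ∀ s t : lamSubK η U₀ L k Eb, ‖s‖ ≤ α₄ / 4 → ‖t‖ ≤ α₄ / 4 → ∀ x, ‖Hc (lamOf s) x - Hc (lamOf t) x‖ ≤ l₀ * ‖s - t‖)
    (hcL1 : ∀ s t : lamSubK η U₀ L k Eb, ‖s‖ ≤ α₄ / 4 → ‖t‖ ≤ α₄ / 4 → ∀ j, j ≤ k → ∀ p ∈ Eb j,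
      wt L η j * ‖covDerivFwd η U₀ p.2 (Hc (lamOf s) - Hc (lamOf t)) p.1‖ ≤ l₁ * ‖s - t‖)
    (hcL2 : ∀ s t : lamSubK η U₀ L k Eb, ‖s‖ ≤ α₄ / 4 → ‖t‖ ≤ α₄ / 4 →
      Bd2 L η k Ω (covLap η U₀ (Hc (lamOf s)) - covLap η U₀ (Hc (lamOf t))) (l₂ * ‖s - t‖))
    (hcsa : ∀ s : lamSubK η U₀ L k Eb, ‖s‖ ≤ α₄ / 4 → (∀ x, IsSelfAdjoint (lamOf s x)) → ∀ x, IsSelfAdjoint (Hc (lamOf s) x))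
    (hcsupp : ∀ s : lamSubK η U₀ L k Eb, ‖s‖ ≤ α₄ / 4 → ∀ x, x ∉ Ω 0 → Hc (lamOf s) x = 0)
    (hDA : Bd2 L η k Ω (fun y => covDivB η U₀ A y) cDA) (hDAsa : ∀ j, j ≤ k → ∀ x ∈ Ω j, IsSelfAdjoint (covDivB η U₀ A x))
    (hA : ∀ j, j ≤ k → ∀ x ∈ Ω j, ∀ μ : Fin d,
      wt L η j * ‖A x μ‖ ≤ cA ∧ wt L η j * ‖conjR (U₀ (x - e μ) μ)⁻¹ (A (x - e μ) μ)‖ ≤ cA)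
    (hAsa : ∀ x μ, IsSelfAdjoint (A x μ))
    (h103 : BG * Mc d BR (α₄ / 4 + h₁) cA h₂ cDA ≤ α₄ / 4)
    (h106 : BG * Kc d BR (α₄ / 4 + h₁) cA h₂ cDA l₂ (1 + l₀) (1 + l₁) ≤ 1 / 2) :
    ∃ (s : lamSubK η U₀ L k Eb) (lam : Site d → 𝔸), ‖s‖ ≤ α₄ / 4 ∧ q (lamOf s) = 0 ∧ lam = lamOf s + Hc (lamOf s) ∧
      (∀ x, IsSelfAdjoint (lam x)) ∧ (∀ x, x ∉ Ω 0 → lam x = 0) ∧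
      (∀ j, j ≤ k → ∀ p ∈ Eb j, ‖lam p.1‖ ≤ α₄ ∧ wt L η j * ‖covDerivFwd η U₀ p.2 lam p.1‖ ≤ α₄) ∧
      (∃ μ : ℕ → Site d → 𝔸, ∀ x ∈ Ω 0,
        covLap η U₀ ((Ω 0).indicator fun y => covDivB η U₀ A y + covLap η U₀ lam y +
          ((conjR (gaugeExp lam y)⁻¹ (covDivB η U₀ A y) - covDivB η U₀ A y) +
            (gAd (covLap η U₀ lam y) (lam y) - covLap η U₀ lam y) + ∑ μ, frakF3 η U₀ lam A y μ)) x = QT L k Λs U₀ μ x) := by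
  -- the letter R of (1.95)
  set R : (Site d → 𝔸) → (Site d → 𝔸) := fun f => f - g (qs (c (q (g f)))) with hRdef
  have hR : ∀ f, R f = f - g (qs (c (q (g f)))) := fun f => rfl
  have hRsub : ∀ f f' : Site d → 𝔸, R (f - f') = R f - R f' := proj325_sub (R := R) hR
  have hR0 : R 0 = 0 := by rw [hR]; simp
  have hRneg : ∀ f : Site d → 𝔸, R (-f) = -R f := fun f => by rw [← zero_sub, hRsub, hR0, zero_sub]
  -- JOIN-A
  obtain ⟨s, s', hs, hfix, hs', hn', hsa', hoff', hN⟩ := gaugeParam_kLevel (Ω := Ω) (Eb := Eb) (U₀ := U₀) (A := A)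
    (DA := fun y => covDivB η U₀ A y) hL hη hU₀ hEbΩ (⇑g) R Hc hα₄.le hBG hBR hh₀ hh₂ hl₀ hl₁ hl₂ hcA hcA' hcDA ha₁' hb₁' hb₁ hθ hh₀'
    hh₁' hG (fun f f' => map_sub g f f') hGsupp hGreal hRsub hRbd hRreal hc0 hc1 hc2 hcL0 hcL1 hcL2 hcsa hcsupp hDA hDAsa hA hAsa h103 h106
  set lam' := lamOf s' with hlam'def
  have hgp : lamOf s + Hc (lamOf s) = lam' := hs'.symm
  -- the Neumann solution at λ′
  set Z : Site d → 𝔸 := Zsol (Wsrc η U₀ A (fun y => covDivB η U₀ A y) lam' (covLap η U₀ (Hc (lamOf s)))) (Vop lam') R with hZdef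
  -- the fixed point read through the projection laws: Q′λ = 0 and Δλ = R(−Z) on Ω₀
  have hfix' : lamOf s = g (R (fun x => -Z x)) := by
    have h := hfix
    simp only [PsiP5] at h
    rw [hgp] at h
    exact h
  have hfix'' : lamOf s = g (R (-Z)) := hfix'
  have hqR : q (g (R (-Z))) = 0 := q_g_proj325_range (R := R) hR c_range (-Z)
  have hq : q (lamOf s) = 0 := by rw [hfix'']; exact hqR
  -- «ΔG′R = R» read POINTWISE on Ω₀ (the right-inverse law of G′ on print's domain)
  have hΔs : ∀ y ∈ Ω 0, Δ (lamOf s) y = R (-Z) y := fun y hy => by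
    have h1 := g_rightΩ (R (-Z)) y hy
    rw [hqR, map_zero, map_zero, add_zero] at h1
    rw [hfix'']
    exact h1
  -- sizes at λ′ on Ω₀
  have hl : ∀ y ∈ Ω 0, ‖lam' y‖ ≤ 1 / 12 := fun y _ => by
    rw [← hgp]; exact (gpar_size hc0 s hs y).trans (ha₁'.trans (by norm_num))
  -- support of λ_s (Dirichlet range of G′)
  have hoff : ∀ x, x ∉ Ω 0 → lamOf s x = 0 := fun x hx => by rw [hfix'']; exact hGsupp _ x hx
  have hind : (Ω 0).indicator (lamOf s) = lamOf s := by
    funext x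
    by_cases hx : x ∈ Ω 0
    · rw [Set.indicator_of_mem hx]
    · rw [Set.indicator_of_notMem hx, hoff x hx]
  refine ⟨s, lam', hs, hq, hgp.symm, hsa', hoff', fun j hj p hp => ?_, ?_⟩
  · -- (1.108)
    have h := (norm_le_iff hη.le s' hα₄.le).1 hn'
    exact ⟨h.1 p.1, h.2 j hj p hp⟩
  · -- the multiplier clause, via n04-b's WHY-Z bridge
    have hdef : lam' = lamOf s - (-Hc (lamOf s)) := by rw [sub_neg_eq_add, hgp]
    have hNy : ∀ y ∈ Ω 0, Z y + (gAd (R Z y) (lam' y) - R Z y) =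
        conjR (gaugeExp lam' y)⁻¹ (covDivB η U₀ A y) - gAd (covLap η U₀ (-Hc (lamOf s)) y) (lam' y) + ∑ μ, frakF3 η U₀ lam' A y μ := by
      intro y hy
      have h := hN 0 (Nat.zero_le _) y hy
      simp only [Vop, Wsrc] at h
      rw [h, covLap_neg', gAd_neg _ (hl y hy), sub_neg_eq_add]
    have hΔy : ∀ y ∈ Ω 0, covLap η U₀ (lamOf s) y = -R Z y := by
      intro y hy
      rw [← hind, ← hΔ _ y hy, hΔs y hy, hRneg, Pi.neg_apply]
    refine (multiplier_iff_of_whyZ L k (Ω 0) Λs U₀ A hdef hl hNy hΔy).2 ?_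
    set φ := c (q (g Z)) with hφ
    refine ⟨φ - Aw (q (g (qs φ))), fun x hx => ?_⟩
    have hZR : Z - R Z = g (qs φ) := by rw [hR]; abel
    -- «ΔG′Q′ᵀφ = Q′ᵀ(φ − 𝔄Q′G′Q′ᵀφ)» read POINTWISE on Ω₀
    have hlap : Δ (g (qs φ)) x = qs (φ - Aw (q (g (qs φ)))) x := by
      rw [map_sub, Pi.sub_apply]
      exact eq_sub_of_add_eq (by rw [← Pi.add_apply]; exact g_rightΩ (qs φ) x hx)
    rw [← hΔ _ x hx, hZR, hlap, hqs _ x hx]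

/-- ★★ **THE SAME WITH A RESTRICTION PREDICATE TRANSFERRED FROM THE LINEAR CONSTRAINT** (the form the knit's sockets want): for ANY `P : (Site d → 𝔸) → Prop` with the
displayed transfer `hP : ‖s‖ ≤ ¼α₄ → Q′λ_s = 0 → P (λ_s + H_cλ_s)` (Sect. E's (1.114) in its printed use for print's (1.29); J4b's mixed (1.114) for the H-line's (o)),
the fixed point `λ′` of `hFP_kLevel_agnostic_RD` satisfies `P λ′` — JOIN-B's conclusion shape with `Restr129 … ↦ P`. [cite: Balaban1985RegularSpaces, Prop. 5 (1.107) p.94, (1.113)–(1.114) p.95] -/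
theorem hFP_kLevel_ofConstraint_RD (hL : 1 ≤ L) (hη : 0 < η) (hU₀ : ∀ x κ, U₀ x κ ∈ unitaryUnits 𝔸)
    (hEbΩ : ∀ j, j ≤ k → ∀ x ∈ Ω j, ∀ μ : Fin d, (x, μ) ∈ Eb j ∧ (x - e μ, μ) ∈ Eb j)
    (g Δ : (Site d → 𝔸) →ₗ[ℂ] (Site d → 𝔸)) (q : (Site d → 𝔸) →ₗ[ℂ] (ℕ → Site d → 𝔸)) (qs : (ℕ → Site d → 𝔸) →ₗ[ℂ] (Site d → 𝔸))
    (Aw c : (ℕ → Site d → 𝔸) →ₗ[ℂ] (ℕ → Site d → 𝔸))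
    (g_rightΩ : ∀ x, ∀ y ∈ Ω 0, (Δ (g x) + qs (Aw (q (g x)))) y = x y)
    (c_range : ∀ f, q (g (g (qs (c (q f))))) = q f)
    (hΔ : ∀ (f : Site d → 𝔸), ∀ x ∈ Ω 0, Δ f x = covLap η U₀ ((Ω 0).indicator f) x)
    (hqs : ∀ (μ : ℕ → Site d → 𝔸), ∀ x ∈ Ω 0, qs μ x = QT L k Λs U₀ μ x)
    (Hc : (Site d → 𝔸) → (Site d → 𝔸))
    {α₄ BG BR h₀ h₁ h₂ l₀ l₁ l₂ cA cDA : ℝ}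
    (hα₄ : 0 < α₄) (hBG : 0 ≤ BG) (hBR : 0 ≤ BR) (hh₀ : 0 ≤ h₀) (hh₂ : 0 ≤ h₂) (hl₀ : 0 ≤ l₀) (hl₁ : 0 ≤ l₁)
    (hl₂ : 0 ≤ l₂) (hcA : 0 ≤ cA) (hcA' : cA ≤ 1 / 13) (hcDA : 0 ≤ cDA)
    (ha₁' : α₄ / 4 + h₀ ≤ 1 / 24) (hb₁' : α₄ / 4 + h₁ ≤ 1 / 140) (hb₁ : 0 < α₄ / 4 + h₁) (hθ : 10 * (α₄ / 4 + h₀) * BR ≤ 1 / 2)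
    (hh₀' : h₀ ≤ 3 * α₄ / 4) (hh₁' : h₁ ≤ 3 * α₄ / 4)
    (hG : ∀ (f : Site d → 𝔸) (m : ℝ), 0 ≤ m → Bd2 L η k Ω f m →
      (∀ x, ‖g f x‖ ≤ BG * m) ∧ ∀ j, j ≤ k → ∀ p ∈ Eb j, wt L η j * ‖covDerivFwd η U₀ p.2 (g f) p.1‖ ≤ BG * m)
    (hGsupp : ∀ (f : Site d → 𝔸) (x : Site d), x ∉ Ω 0 → g f x = 0)
    (hGreal : ∀ f : Site d → 𝔸, (∀ j, j ≤ k → ∀ x ∈ Ω j, IsSelfAdjoint (f x)) → ∀ x, IsSelfAdjoint (g f x))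
    (hRbd : ∀ (f : Site d → 𝔸) (m : ℝ), 0 ≤ m → Bd2 L η k Ω f m → Bd2 L η k Ω (f - g (qs (c (q (g f))))) (BR * m))
    (hRreal : ∀ f : Site d → 𝔸, (∀ j, j ≤ k → ∀ x ∈ Ω j, IsSelfAdjoint (f x)) →
      ∀ j, j ≤ k → ∀ x ∈ Ω j, IsSelfAdjoint ((f - g (qs (c (q (g f))))) x))
    (hc0 : ∀ s : lamSubK η U₀ L k Eb, ‖s‖ ≤ α₄ / 4 → ∀ x, ‖Hc (lamOf s) x‖ ≤ h₀)
    (hc1 : ∀ s : lamSubK η U₀ L k Eb, ‖s‖ ≤ α₄ / 4 → ∀ j, j ≤ k → ∀ p ∈ Eb j, wt L η j * ‖covDerivFwd η U₀ p.2 (Hc (lamOf s)) p.1‖ ≤ h₁)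
    (hc2 : ∀ s : lamSubK η U₀ L k Eb, ‖s‖ ≤ α₄ / 4 → Bd2 L η k Ω (covLap η U₀ (Hc (lamOf s))) h₂)
    (hcL0 : ∀ s t : lamSubK η U₀ L k Eb, ‖s‖ ≤ α₄ / 4 → ‖t‖ ≤ α₄ / 4 → ∀ x, ‖Hc (lamOf s) x - Hc (lamOf t) x‖ ≤ l₀ * ‖s - t‖)
    (hcL1 : ∀ s t : lamSubK η U₀ L k Eb, ‖s‖ ≤ α₄ / 4 → ‖t‖ ≤ α₄ / 4 → ∀ j, j ≤ k → ∀ p ∈ Eb j,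
      wt L η j * ‖covDerivFwd η U₀ p.2 (Hc (lamOf s) - Hc (lamOf t)) p.1‖ ≤ l₁ * ‖s - t‖)
    (hcL2 : ∀ s t : lamSubK η U₀ L k Eb, ‖s‖ ≤ α₄ / 4 → ‖t‖ ≤ α₄ / 4 →
      Bd2 L η k Ω (covLap η U₀ (Hc (lamOf s)) - covLap η U₀ (Hc (lamOf t))) (l₂ * ‖s - t‖))
    (hcsa : ∀ s : lamSubK η U₀ L k Eb, ‖s‖ ≤ α₄ / 4 → (∀ x, IsSelfAdjoint (lamOf s x)) → ∀ x, IsSelfAdjoint (Hc (lamOf s) x))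
    (hcsupp : ∀ s : lamSubK η U₀ L k Eb, ‖s‖ ≤ α₄ / 4 → ∀ x, x ∉ Ω 0 → Hc (lamOf s) x = 0)
    (hDA : Bd2 L η k Ω (fun y => covDivB η U₀ A y) cDA) (hDAsa : ∀ j, j ≤ k → ∀ x ∈ Ω j, IsSelfAdjoint (covDivB η U₀ A x))
    (hA : ∀ j, j ≤ k → ∀ x ∈ Ω j, ∀ μ : Fin d,
      wt L η j * ‖A x μ‖ ≤ cA ∧ wt L η j * ‖conjR (U₀ (x - e μ) μ)⁻¹ (A (x - e μ) μ)‖ ≤ cA)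
    (hAsa : ∀ x μ, IsSelfAdjoint (A x μ))
    (h103 : BG * Mc d BR (α₄ / 4 + h₁) cA h₂ cDA ≤ α₄ / 4)
    (h106 : BG * Kc d BR (α₄ / 4 + h₁) cA h₂ cDA l₂ (1 + l₀) (1 + l₁) ≤ 1 / 2)
    -- the restriction: ANY predicate on the final gauge parameter, transferred from the linear constraint `Q′λ = 0`
    (P : (Site d → 𝔸) → Prop)
    (hP : ∀ s : lamSubK η U₀ L k Eb, ‖s‖ ≤ α₄ / 4 → q (lamOf s) = 0 → P (lamOf s + Hc (lamOf s))) :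
    ∃ lam : Site d → 𝔸, (∀ x, IsSelfAdjoint (lam x)) ∧ (∀ x, x ∉ Ω 0 → lam x = 0) ∧
      (∀ j, j ≤ k → ∀ p ∈ Eb j, ‖lam p.1‖ ≤ α₄ ∧ wt L η j * ‖covDerivFwd η U₀ p.2 lam p.1‖ ≤ α₄) ∧
      (∃ μ : ℕ → Site d → 𝔸, ∀ x ∈ Ω 0,
        covLap η U₀ ((Ω 0).indicator fun y => covDivB η U₀ A y + covLap η U₀ lam y +
          ((conjR (gaugeExp lam y)⁻¹ (covDivB η U₀ A y) - covDivB η U₀ A y) +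
            (gAd (covLap η U₀ lam y) (lam y) - covLap η U₀ lam y) + ∑ μ, frakF3 η U₀ lam A y μ)) x = QT L k Λs U₀ μ x) ∧
      P lam := by
  obtain ⟨s, lam, hs, hq, hlam, hsa, hoff, h108, hmult⟩ := hFP_kLevel_agnostic_RD hL hη hU₀ hEbΩ g Δ q qs Aw c g_rightΩ c_range hΔ hqs Hc hα₄
    hBG hBR hh₀ hh₂ hl₀ hl₁ hl₂ hcA hcA' hcDA ha₁' hb₁' hb₁ hθ hh₀' hh₁' hG hGsupp hGreal hRbd hRreal hc0 hc1 hc2 hcL0 hcL1 hcL2 hcsa hcsupp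
    hDA hDAsa hA hAsa h103 h106
  exact ⟨lam, hsa, hoff, h108, hmult, hlam ▸ hP s hs hq⟩

end Generic

end Summit.QuantumFields.YangMills.Theorems.HalvingP1FlatCoreTopStep

end
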